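import Literature.NumberTheory.Transcendental.ZudilinPhase
import Literature.Analysis.SpecialFunctions.LogSumTrapezoid
import HarnessLib

/-!
# The Pochhammer blocks of Zudilin's `Rₙ(nκ)`: first-order asymptotics of `Σ log(κ ± i/n)`

Topic `Literature/NumberTheory/Transcendental`; continues `ZudilinPhase.lean`
(`Literature.NumberTheory.Transcendental.Zudilin2004.blockInt`). Everything here is PROVED; no
definitions, no named facts.

For `κ` in the half-plane `im κ ≥ u₁ > 0` and `n ≥ 1`, the three kinds of blocks of
`Rₙ(k)` at `k = nκ` ([Zudilin2004, §8 (8.7) at the parameters of Thm. 3], Fischler's variable)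
satisfy, with `B = blockInt` (`B κ a b = ∫_a^b log(κ+x) dx`) and absolute constants depending on
`u₁` only:

* `norm_blockSum_one_sub_le` — `Σ_{i=1}^{27n} log(κ − i/n) = n B(κ,−27,0) + ½(log(κ−27) − log κ) + O(1/n)`;
* `norm_blockSum_two_sub_le` — `Σ_{i=37n+1}^{64n} log(κ + i/n) = n B(κ,37,64) + ½(log(κ+64) − log(κ+37)) + O(1/n)`;
* `norm_blockSum_den_sub_le` — for `1 ≤ v ≤ 10`:
  `Σ_{i=(12−v)n}^{(25+v)n} log(κ + i/n) = n B(κ,12−v,25+v) + ½(log(κ+12−v) + log(κ+25+v)) + O(1/n)`,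

from the Euler–Maclaurin estimate `Literature.Analysis.SpecialFunctions.norm_sum_log_sub_le` and
the elementary bounds `‖log(κ+h) − log κ‖ ≤ |h|/u₁`, `‖B(κ,a,a+h) − h log(κ+a)‖ ≤ h²/u₁`
(`norm_log_add_sub_log_le`, `norm_blockInt_sub_mul_log_le`). Summing with weights `3, 3, −1`
gives the exponent `n ψ(κ) + (A(κ) − log(37+2κ) − C₂) + o(1)` of `Rₙ(nκ)` without its
normalising constant ([Zudilin2004, Lemma 20]; the shape of [Zudilin2002, §4 Lemma 3]).

## References

* [Zudilin2004] W. Zudilin, J. Théor. Nombres Bordeaux 16 (2004), §8 (8.7), Lemma 20.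
* [Zudilin2002] W. Zudilin, Izv. Math. 66 (2002), §4, Lemma 3.
-/

noncomputable section

open Finset Complex MeasureTheory intervalIntegral
open Literature.Analysis.SpecialFunctions

namespace Literature.NumberTheory.Transcendental

namespace Zudilin2004

/-! ### Elementary Lipschitz-type bounds in `im κ ≥ u₁` -/

/-- `‖(κ + t)⁻¹‖ ≤ 1/u₁` for real `t` when `im κ ≥ u₁ > 0`. [folklore] -/
theorem norm_inv_add_real_le {κ : ℂ} {u₁ : ℝ} (hu : 0 < u₁) (hκ : u₁ ≤ κ.im) (t : ℝ) :
    ‖(κ + t)⁻¹‖ ≤ 1 / u₁ := by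
  rw [norm_inv, one_div]
  refine inv_anti₀ hu (hκ.trans ((le_abs_self _).trans ?_))
  simpa using abs_im_le_norm (κ + t)

/-- **`‖log(κ + h) − log κ‖ ≤ |h|/u₁`** for real `h`, `im κ ≥ u₁ > 0`. [folklore] -/
theorem norm_log_add_sub_log_le {κ : ℂ} {u₁ : ℝ} (hu : 0 < u₁) (hκ : u₁ ≤ κ.im) (h : ℝ) :
    ‖log (κ + h) - log κ‖ ≤ |h| / u₁ := by
  have hκ0 : κ.im ≠ 0 := by linarith
  have hderiv : ∀ t ∈ Set.uIcc 0 h, HasDerivAt (fun t : ℝ ↦ log (κ + t)) ((κ + t)⁻¹) t :=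
    fun t _ ↦ hasDerivAt_log_add_ofReal hκ0 t
  have hcont : ContinuousOn (fun t : ℝ ↦ (κ + t)⁻¹) (Set.uIcc 0 h) := fun t _ ↦
    (hasDerivAt_inv_add_ofReal hκ0 t).continuousAt.continuousWithinAt
  have hftc := integral_eq_sub_of_hasDerivAt hderiv (hcont.intervalIntegrable)
  simp only [ofReal_zero, add_zero] at hftc
  rw [← hftc]
  have := norm_integral_le_of_norm_le_const (a := 0) (b := h) (C := 1 / u₁)
    (f := fun t : ℝ ↦ (κ + t)⁻¹) fun t _ ↦ norm_inv_add_real_le hu hκ t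
  simpa [div_eq_mul_inv, mul_comm] using this

/-- `blockInt κ a b = ∫_a^b log(κ + x) dx` for `im κ ≠ 0`. [folklore] -/
theorem blockInt_eq_integral {κ : ℂ} (hκ : κ.im ≠ 0) (a b : ℝ) :
    blockInt κ a b = ∫ x in a..b, log (κ + x) := by
  rw [integral_log_add_eq hκ]; rfl

/-- Additivity: `blockInt κ a b + blockInt κ b c = blockInt κ a c`. [folklore] -/
theorem blockInt_add (κ : ℂ) (a b c : ℝ) : blockInt κ a b + blockInt κ b c = blockInt κ a c := by
  unfold blockInt; ring

/-- **`‖blockInt κ a (a+h) − h log(κ+a)‖ ≤ h²/u₁`** for `h ≥ 0`, `im κ ≥ u₁ > 0`. [folklore] -/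
theorem norm_blockInt_sub_mul_log_le {κ : ℂ} {u₁ : ℝ} (hu : 0 < u₁) (hκ : u₁ ≤ κ.im) (a : ℝ)
    {h : ℝ} (hh : 0 ≤ h) :
    ‖blockInt κ a (a + h) - h * log (κ + a)‖ ≤ h ^ 2 / u₁ := by
  have hκ0 : κ.im ≠ 0 := by linarith
  rw [blockInt_eq_integral hκ0]
  have hint : IntervalIntegrable (fun x : ℝ ↦ log (κ + x)) volume a (a + h) := by
    refine ContinuousOn.intervalIntegrable fun x _ ↦ ?_
    exact (hasDerivAt_log_add_ofReal hκ0 x).continuousAt.continuousWithinAt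
  have hconst : ∫ _ in a..(a + h), log (κ + a) = h * log (κ + a) := by
    rw [intervalIntegral.integral_const]; simp
  rw [← hconst, ← intervalIntegral.integral_sub hint intervalIntegrable_const]
  have hb : ∀ x ∈ Set.uIoc a (a + h), ‖log (κ + x) - log (κ + a)‖ ≤ h / u₁ := by
    intro x hx
    rw [Set.uIoc_of_le (by linarith)] at hx
    have := norm_log_add_sub_log_le hu (κ := κ + a) (by simpa using hκ) (x - a)
    have e : κ + a + ((x - a : ℝ) : ℂ) = κ + x := by push_cast; ring
    rw [e] at this
    refine this.trans ?_
    rw [abs_of_nonneg (by linarith [hx.1])]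
    exact div_le_div_of_nonneg_right (by linarith [hx.2]) hu.le
  have := norm_integral_le_of_norm_le_const hb
  rw [show a + h - a = h by ring, abs_of_nonneg hh] at this
  calc _ ≤ h / u₁ * h := this
    _ = h ^ 2 / u₁ := by ring

/-! ### Reindexing the blocks onto the grid of `norm_sum_log_sub_le` -/

/-- Block of the first kind: `Σ_{i=1}^{27n} log(κ − i/n) = Σ_{j<27n} log(κ + (−27n + j)/n)`.
[folklore] -/
theorem blockSum_one_reindex (κ : ℂ) (n : ℕ) :
    ∑ i ∈ Icc 1 (27 * n), log (κ - (i : ℂ) / n) =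
      ∑ j ∈ range (27 * n), log (κ + (((((-(27 * n : ℕ) : ℤ)) : ℝ) + j) / n : ℝ)) := by
  rw [← Finset.Ico_add_one_right_eq_Icc, sum_Ico_eq_sum_range, show 27 * n + 1 - 1 = 27 * n from rfl,
    ← sum_range_reflect]
  refine sum_congr rfl fun j hj ↦ ?_
  have hj' := mem_range.1 hj
  congr 1
  have hcast : ((1 + (27 * n - 1 - j) : ℕ) : ℂ) = 27 * n - j := by
    rw [Nat.cast_add, Nat.cast_sub (by omega), Nat.cast_sub (by omega)]; push_cast; ring
  rw [hcast]
  push_cast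
  ring

/-- Block of the second kind: `Σ_{i=37n+1}^{64n} log(κ + i/n) = Σ_{j<27n} log(κ + (37n+1+j)/n)`.
[folklore] -/
theorem blockSum_two_reindex (κ : ℂ) (n : ℕ) :
    ∑ i ∈ Icc (37 * n + 1) (64 * n), log (κ + (i : ℂ) / n) =
      ∑ j ∈ range (27 * n), log (κ + (((((37 * n + 1 : ℕ) : ℤ) : ℝ) + j) / n : ℝ)) := by
  rw [← Finset.Ico_add_one_right_eq_Icc, sum_Ico_eq_sum_range, show 64 * n + 1 - (37 * n + 1) = 27 * n by omega]
  refine sum_congr rfl fun j _ ↦ ?_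
  congr 1
  push_cast
  ring

/-- Denominator block: `Σ_{i=(12−v)n}^{(25+v)n} log(κ + i/n) = Σ_{j ≤ (13+2v)n} log(κ + ((12−v)n+j)/n)`
(`v ≤ 12`). [folklore] -/
theorem blockSum_den_reindex (κ : ℂ) (n : ℕ) {v : ℕ} (hv : v ≤ 12) :
    ∑ i ∈ Icc ((12 - v) * n) ((25 + v) * n), log (κ + (i : ℂ) / n) =
      ∑ j ∈ range ((13 + 2 * v) * n + 1),
        log (κ + ((((((12 - v) * n : ℕ) : ℤ) : ℝ) + j) / n : ℝ)) := by
  have hle : (12 - v) * n ≤ (25 + v) * n := Nat.mul_le_mul_right n (by omega)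
  have hlen : (25 + v) * n + 1 - (12 - v) * n = (13 + 2 * v) * n + 1 := by
    have : (25 + v) * n = (13 + 2 * v) * n + (12 - v) * n := by
      rw [← Nat.add_mul]; congr 1; omega
    rw [this]
    generalize (13 + 2 * v) * n = a
    generalize (12 - v) * n = b
    omega
  rw [← Finset.Ico_add_one_right_eq_Icc, sum_Ico_eq_sum_range, hlen]
  refine sum_congr rfl fun j _ ↦ ?_
  congr 1
  push_cast
  ring


/-! ### The three block estimates -/

/-- **Denominator blocks** (`1 ≤ v ≤ 10`, exact grid): for `n ≥ 1`, `im κ ≥ u₁ > 0`,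
`‖Σ_{i=(12−v)n}^{(25+v)n} log(κ + i/n) − (n B(κ,12−v,25+v) + ½(log(κ+12−v) + log(κ+25+v)))‖ ≤ 3/(n u₁²)`.
[cite: Zudilin2004, §8 Lemma 20] -/
theorem norm_blockSum_den_sub_le {κ : ℂ} {u₁ : ℝ} (hu : 0 < u₁) (hκ : u₁ ≤ κ.im) {n : ℕ}
    (hn : 1 ≤ n) {v : ℕ} (hv : v ∈ Icc 1 10) :
    ‖(∑ i ∈ Icc ((12 - v) * n) ((25 + v) * n), log (κ + (i : ℂ) / n)) -
        ((n : ℂ) * blockInt κ (12 - (v : ℝ)) (25 + (v : ℝ)) +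
          1 / 2 * (log (κ + 12 - (v : ℂ)) + log (κ + 25 + (v : ℂ))))‖ ≤ 3 / (n * u₁ ^ 2) := by
  have hv' := (mem_Icc.1 hv).2
  have hκ0 : κ.im ≠ 0 := by linarith
  have hn' : (0 : ℝ) < n := by exact_mod_cast hn
  have habs : u₁ ≤ |κ.im| := hκ.trans (le_abs_self _)
  rw [blockSum_den_reindex κ n (by omega)]
  have h := norm_sum_log_sub_le hu habs hn (((12 - v) * n : ℕ) : ℤ) ((13 + 2 * v) * n)
  -- identify the endpoints
  have hA : ((((12 - v) * n : ℕ) : ℤ) : ℝ) / n = 12 - (v : ℝ) := by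
    push_cast [Nat.cast_sub (show v ≤ 12 by omega)]
    field_simp
  have hB : (((((12 - v) * n : ℕ) : ℤ) : ℝ) + ((13 + 2 * v) * n : ℕ)) / n = 25 + (v : ℝ) := by
    push_cast [Nat.cast_sub (show v ≤ 12 by omega)]
    field_simp
    ring
  rw [hA, hB, ← blockInt_eq_integral hκ0] at h
  have hcast1 : (κ + ((12 - (v : ℝ) : ℝ) : ℂ)) = κ + 12 - (v : ℂ) := by push_cast; ring
  have hcast2 : (κ + ((25 + (v : ℝ) : ℝ) : ℂ)) = κ + 25 + (v : ℂ) := by push_cast; ring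
  rw [hcast1, hcast2] at h
  refine (le_of_eq ?_).trans (h.trans ?_)
  · congr 1; ring
  · rw [div_le_div_iff₀ (by positivity) (by positivity)]
    have h33 : ((((13 + 2 * v) * n : ℕ)) : ℝ) ≤ 33 * n := by
      have : (13 + 2 * v) * n ≤ 33 * n := Nat.mul_le_mul_right n (by omega)
      exact_mod_cast this
    have hprod := mul_le_mul_of_nonneg_right h33 (by positivity : (0 : ℝ) ≤ n * u₁ ^ 2)
    nlinarith [hprod, mul_pos hn' (pow_pos hu 2)]

/-- **Blocks of the second kind**: for `n ≥ 1`, `im κ ≥ u₁ > 0`,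
`‖Σ_{i=37n+1}^{64n} log(κ + i/n) − (n B(κ,37,64) + ½(log(κ+64) − log(κ+37)))‖ ≤ (3/u₁² + 2/u₁)/n`.
[cite: Zudilin2004, §8 Lemma 20] -/
theorem norm_blockSum_two_sub_le {κ : ℂ} {u₁ : ℝ} (hu : 0 < u₁) (hκ : u₁ ≤ κ.im) {n : ℕ}
    (hn : 1 ≤ n) :
    ‖(∑ i ∈ Icc (37 * n + 1) (64 * n), log (κ + (i : ℂ) / n)) -
        ((n : ℂ) * blockInt κ 37 64 + 1 / 2 * (log (κ + 64) - log (κ + 37)))‖ ≤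
      (3 / u₁ ^ 2 + 2 / u₁) / n := by
  have hκ0 : κ.im ≠ 0 := by linarith
  have hn' : (0 : ℝ) < n := by exact_mod_cast hn
  have habs : u₁ ≤ |κ.im| := hκ.trans (le_abs_self _)
  rw [blockSum_two_reindex κ n]
  have h27 : 27 * n = (27 * n - 1) + 1 := by omega
  have h := norm_sum_log_sub_le hu habs hn ((37 * n + 1 : ℕ) : ℤ) (27 * n - 1)
  rw [← h27] at h
  have hA : (((37 * n + 1 : ℕ) : ℤ) : ℝ) / n = 37 + 1 / n := by
    push_cast; field_simp
  have hB : ((((37 * n + 1 : ℕ) : ℤ) : ℝ) + ((27 * n - 1 : ℕ) : ℝ)) / n = 64 := by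
    rw [Nat.cast_sub (by omega)]; push_cast; field_simp; ring
  rw [hA, hB, ← blockInt_eq_integral hκ0] at h
  -- the two small corrections
  have hκ37 : u₁ ≤ (κ + 37).im := by simpa using hκ
  have e1 := norm_log_add_sub_log_le hu hκ37 (1 / n)
  have e2 := norm_blockInt_sub_mul_log_le hu hκ (37 : ℝ) (h := 1 / n) (by positivity)
  rw [abs_of_pos (by positivity)] at e1
  have hsplit : blockInt κ (37 + 1 / n) 64 = blockInt κ 37 64 - blockInt κ 37 (37 + 1 / n) := by
    rw [← blockInt_add κ 37 (37 + 1 / n) 64]; ring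
  rw [hsplit] at h
  have hc1 : (κ + ((37 + 1 / n : ℝ) : ℂ)) = κ + 37 + ((1 / n : ℝ) : ℂ) := by push_cast; ring
  have hc2 : (κ + ((64 : ℝ) : ℂ)) = κ + 64 := by push_cast; ring
  have hc3 : (κ + ((37 : ℝ) : ℂ)) = κ + 37 := by push_cast; ring
  rw [hc1, hc2] at h
  rw [hc3] at e2
  -- algebra: `Σ − T = E + ½(log(κ+37+1/n) − log(κ+37)) − (n B(37,37+1/n) − log(κ+37))`
  set Sg := ∑ j ∈ range (27 * n), log (κ + (((((37 * n + 1 : ℕ) : ℤ) : ℝ) + j) / n : ℝ)) with hSg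
  set E := Sg - 1 / 2 * (log (κ + 37 + ((1 / n : ℝ) : ℂ)) + log (κ + 64)) -
    (n : ℂ) * (blockInt κ 37 64 - blockInt κ 37 (37 + 1 / n)) with hE
  have hkey : Sg - ((n : ℂ) * blockInt κ 37 64 + 1 / 2 * (log (κ + 64) - log (κ + 37))) =
      E + 1 / 2 * (log (κ + 37 + ((1 / n : ℝ) : ℂ)) - log (κ + 37)) -
        (n : ℂ) * (blockInt κ 37 (37 + 1 / n) - (1 / n : ℝ) * log (κ + 37)) := by
    rw [hE]
    have hn0 : (n : ℂ) ≠ 0 := by exact_mod_cast hn'.ne'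
    push_cast
    field_simp
    ring
  rw [hkey]
  have hn1 : ‖(n : ℂ)‖ = n := by simp
  calc _ ≤ ‖E‖ + ‖1 / 2 * (log (κ + 37 + ((1 / n : ℝ) : ℂ)) - log (κ + 37))‖ +
        ‖(n : ℂ) * (blockInt κ 37 (37 + 1 / n) - (1 / n : ℝ) * log (κ + 37))‖ := norm_sub_le_of_le
          (norm_add_le _ _) le_rfl
    _ ≤ (27 * n - 1 : ℕ) / (12 * (n : ℝ) ^ 2 * u₁ ^ 2) + 1 / 2 * (1 / n / u₁) + n * ((1 / n) ^ 2 / u₁) := by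
        refine add_le_add (add_le_add h ?_) ?_
        · rw [norm_mul, show ‖(1 / 2 : ℂ)‖ = 1 / 2 by norm_num]
          exact mul_le_mul_of_nonneg_left e1 (by norm_num)
        · rw [norm_mul, hn1]; exact mul_le_mul_of_nonneg_left e2 hn'.le
    _ ≤ (3 / u₁ ^ 2 + 2 / u₁) / n := by
        have h27le : ((27 * n - 1 : ℕ) : ℝ) ≤ 27 * n := by
          rw [Nat.cast_sub (by omega)]; push_cast; linarith
        have hu2 : 0 < u₁ ^ 2 := by positivity
        field_simp
        nlinarith [h27le, hn', hu, mul_pos hn' hu]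


/-- **Blocks of the first kind**: for `n ≥ 1`, `im κ ≥ u₁ > 0`,
`‖Σ_{i=1}^{27n} log(κ − i/n) − (n B(κ,−27,0) + ½(log(κ−27) − log κ))‖ ≤ (3/u₁² + 2/u₁)/n`.
[cite: Zudilin2004, §8 Lemma 20] -/
theorem norm_blockSum_one_sub_le {κ : ℂ} {u₁ : ℝ} (hu : 0 < u₁) (hκ : u₁ ≤ κ.im) {n : ℕ}
    (hn : 1 ≤ n) :
    ‖(∑ i ∈ Icc 1 (27 * n), log (κ - (i : ℂ) / n)) -
        ((n : ℂ) * blockInt κ (-27) 0 + 1 / 2 * (log (κ - 27) - log κ))‖ ≤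
      (3 / u₁ ^ 2 + 2 / u₁) / n := by
  have hκ0 : κ.im ≠ 0 := by linarith
  have hn' : (0 : ℝ) < n := by exact_mod_cast hn
  have habs : u₁ ≤ |κ.im| := hκ.trans (le_abs_self _)
  rw [blockSum_one_reindex κ n]
  have h27 : 27 * n = (27 * n - 1) + 1 := by omega
  have h := norm_sum_log_sub_le hu habs hn (-(27 * n : ℕ) : ℤ) (27 * n - 1)
  rw [← h27] at h
  have hA : (((-(27 * n : ℕ) : ℤ)) : ℝ) / n = -27 := by
    push_cast; field_simp
  have hB : ((((-(27 * n : ℕ) : ℤ)) : ℝ) + ((27 * n - 1 : ℕ) : ℝ)) / n = -(1 / n) := by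
    rw [Nat.cast_sub (by omega)]; push_cast; field_simp; ring
  rw [hA, hB, ← blockInt_eq_integral hκ0] at h
  -- the two small corrections, based at `κ - 1/n`
  have hκ' : u₁ ≤ (κ + ((-(1 / n) : ℝ) : ℂ)).im := by simpa using hκ
  have e1 := norm_log_add_sub_log_le hu hκ' (1 / n)
  have e2 := norm_blockInt_sub_mul_log_le hu hκ (-(1 / n) : ℝ) (h := 1 / n) (by positivity)
  rw [abs_of_pos (by positivity)] at e1
  have hsplit : blockInt κ (-27) (-(1 / n)) = blockInt κ (-27) 0 - blockInt κ (-(1 / n)) 0 := by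
    rw [← blockInt_add κ (-27) (-(1 / n)) 0]; ring
  rw [hsplit] at h
  have hzero : (-(1 / (n : ℝ)) + 1 / n : ℝ) = 0 := by ring
  rw [hzero] at e2
  have hc0 : κ + ((-(1 / n) : ℝ) : ℂ) + ((1 / n : ℝ) : ℂ) = κ := by push_cast; ring
  rw [hc0] at e1
  have hc1 : (κ + ((-27 : ℝ) : ℂ)) = κ - 27 := by push_cast; ring
  rw [hc1] at h
  -- algebra: `Σ − T = E − (n B(−1/n,0) − log(κ−1/n)) + ½(log κ − log(κ−1/n))`
  set Sg := ∑ j ∈ range (27 * n), log (κ + (((((-(27 * n : ℕ) : ℤ)) : ℝ) + j) / n : ℝ)) with hSg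
  set w : ℂ := κ + ((-(1 / n) : ℝ) : ℂ) with hw
  set E := Sg - 1 / 2 * (log (κ - 27) + log w) -
    (n : ℂ) * (blockInt κ (-27) 0 - blockInt κ (-(1 / n)) 0) with hE
  have hkey : Sg - ((n : ℂ) * blockInt κ (-27) 0 + 1 / 2 * (log (κ - 27) - log κ)) =
      E - (n : ℂ) * (blockInt κ (-(1 / n)) 0 - (1 / n : ℝ) * log w) + 1 / 2 * (log κ - log w) := by
    rw [hE]
    have hn0 : (n : ℂ) ≠ 0 := by exact_mod_cast hn'.ne'
    push_cast
    field_simp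
    ring
  rw [hkey]
  have hn1 : ‖(n : ℂ)‖ = n := by simp
  have e1' : ‖log κ - log w‖ ≤ 1 / n / u₁ := e1
  calc _ ≤ ‖E‖ + ‖(n : ℂ) * (blockInt κ (-(1 / n)) 0 - (1 / n : ℝ) * log w)‖ +
        ‖1 / 2 * (log κ - log w)‖ := norm_add_le_of_le (norm_sub_le _ _) le_rfl
    _ ≤ (27 * n - 1 : ℕ) / (12 * (n : ℝ) ^ 2 * u₁ ^ 2) + n * ((1 / n) ^ 2 / u₁) + 1 / 2 * (1 / n / u₁) := by
        refine add_le_add (add_le_add h ?_) ?_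
        · rw [norm_mul, hn1]; exact mul_le_mul_of_nonneg_left e2 hn'.le
        · rw [norm_mul, show ‖(1 / 2 : ℂ)‖ = 1 / 2 by norm_num]
          exact mul_le_mul_of_nonneg_left e1' (by norm_num)
    _ ≤ (3 / u₁ ^ 2 + 2 / u₁) / n := by
        have h27le : ((27 * n - 1 : ℕ) : ℝ) ≤ 27 * n := by
          rw [Nat.cast_sub (by omega)]; push_cast; linarith
        field_simp
        nlinarith [h27le, hn', hu, mul_pos hn' hu]

end Zudilin2004

end Literature.NumberTheory.Transcendental
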